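import Summits.CriticalPhenomena.PercolationContinuityZ3.Theorems.PercNearOneGluingNoHeavyQuantThreeClusterCutOff
import Summits.CriticalPhenomena.PercolationContinuityZ3.Theorems.PercNearOneGluingNoHeavyQuantProductRowClassCount
import HarnessLib

/-!
# Per-class counting form of the seal and cut-off injections (the maps of p1 g40 / p1 g42 as injections of finite sets)

builds on p205010 (kernel theorem, internal audit signed; external expert review pending)

Support file (`--supports stmt-CriticalPhenomena-4575`), seat `prim-quant-p1` (gen 42); memo
`run/shared/lean/prim/quant/prim-quant-p1-g42/FOR-LEAD-Z32-CUTOFF.md` §2.  No definitions, no named facts, no sorries; standard axioms.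

The coefficientwise ("per-class", p1 g41 ✓ p583525 `ThreeClusterSwap.productRow_of_classCount`) form of the two-configuration
method: in a class `I ⊆ U` of edges (`F = U ∖ I` free, `C₁ = I ∪ T ∈ abc`, `C₂ = I ∪ (F ∖ T) ∈ a|b|c`, `T ⊆ F`) the two
configurations are COMPLEMENTARY on `F`, every injection of finite sets is admissible, and the count `TN ≤ m·E` on all classes
gives the product row F1 with constant `m` for every weight vector.  This file transports the two injective maps of the weighted
files (the SEAL of p1 g40, ✓ p575478, and the CUT-OFF of p1 g42, ✓ p611042) to this counting world:
* `flipOn_flipOn`, `coe_union_flipOn` — the complement-on-a-region involution `T ↦ (T ∖ G) ∪ ((F ∖ T) ∩ G)` of `F.powerset`;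
* `classCount_seal_le` — `#{T : c ∉ C_? , a ↮_{C₂} c, a ↔ b in C₁ off the edges touching C_c(C₂)} ≤ #{T : I ∪ T ∈ ab|c}`
  (seal towards `c`; the map flips `T` on the edges of `F` touching `C_c(C₂)`, decoded as `C_c` of the image);
* `classCount_cut_le` — `#{T : b ↮_{C₂} c, σ_b fails, a ↔ b in C₁ ∖ E(Q_c, C_b(C₂))} ≤ #{T : I ∪ T ∈ ab|c}` (cut-off towards
  `c`; the map deletes `E(Q_c, C_b(C₂)) ∩ F` from `T` — all those edges lie in `T` — decoded by `cut_reachable_iff`/`cut_decode_b`);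
* companion file `…QuantThreeClusterCountResidual`: `TN ≤ 2·E + #R₀` on every class and
  `#R₀ ≤ E on every class ⟹ P(abc)·P(a|b|c) ≤ 3·(P(ab|c)+P(ac|b))` (✓ p583525 with `m = 3`).
-/

namespace Summit.CriticalPhenomena.PercolationContinuityZ3.Theorems

open Finset Literature.Probability.Percolation Literature.Probability.Percolation.DecisionTree

variable {V : Type*}

namespace ThreeClusterSwap

/-! ### The flip-on-a-region involution of `F.powerset` -/

open scoped Classical

section Flip

variable {α : Type*} [DecidableEq α]

/-- Flipping a configuration `T ⊆ F` to its complement on the region `G`, twice, gives back `T`. [this work] -/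
theorem flipOn_flipOn (F G T : Finset α) (hT : T ⊆ F) :
    (((T \ G) ∪ ((F \ T) ∩ G)) \ G) ∪ ((F \ ((T \ G) ∪ ((F \ T) ∩ G))) ∩ G) = T := by
  ext e
  simp only [mem_union, mem_sdiff, mem_inter]
  by_cases he : e ∈ G
  · constructor
    · rintro (⟨_, h⟩ | ⟨⟨hF, h⟩, -⟩)
      · exact (h he).elim
      · by_contra heT; exact h (Or.inr ⟨⟨hF, heT⟩, he⟩)
    · intro heT; exact Or.inr ⟨⟨hT heT, fun h => h.elim (fun h => h.2 he) fun h => h.1.2 heT⟩, he⟩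
  · constructor
    · rintro (⟨h | h, -⟩ | ⟨-, h⟩)
      · exact h.1
      · exact (he h.2).elim
      · exact (he h).elim
    · intro heT; exact Or.inl ⟨Or.inl ⟨heT, he⟩, he⟩

/-- The flipped configuration stays inside `F`. [this work] -/
theorem flipOn_subset (F G T : Finset α) (hT : T ⊆ F) : (T \ G) ∪ ((F \ T) ∩ G) ⊆ F := by
  intro e he
  rcases mem_union.1 he with h | h
  · exact hT (mem_sdiff.1 h).1
  · exact (mem_sdiff.1 (mem_inter.1 h).1).1

/-- Coercion of `I ∪ flip`: with `G = {e ∈ F | e ∈ TK}`, `↑(I ∪ ((T ∖ G) ∪ ((F ∖ T) ∩ G)))` is the splice taking the values of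
`I ∪ (F ∖ T)` on `TK` and of `I ∪ T` off `TK`. [this work] -/
theorem coe_union_flipOn (I F T G : Finset α) (TK : Set α) (hT : T ⊆ F) (hG : ∀ e, e ∈ G ↔ e ∈ F ∧ e ∈ TK) :
    (↑(I ∪ ((T \ G) ∪ ((F \ T) ∩ G))) : Set α) = (((↑(I ∪ (F \ T)) : Set α) ∩ TK) ∪ ((↑(I ∪ T) : Set α) \ TK)) := by
  ext e
  have h1 : e ∈ T → e ∈ F := fun h => hT h
  have h2 := hG e
  simp only [Finset.coe_union, Finset.coe_sdiff, Finset.coe_inter, Set.mem_union, Set.mem_sdiff, Set.mem_inter_iff,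
    Finset.mem_coe]
  tauto

/-- Coercion of `I ∪ T'` for `T' = T minus D`, when `D` misses `I`. [this work] -/
theorem coe_union_filter_not (I T T' : Finset α) (D : Set α) (hT' : ∀ e, e ∈ T' ↔ e ∈ T ∧ e ∉ D)
    (hI : ∀ e ∈ D, e ∉ I) : (↑(I ∪ T') : Set α) = (↑(I ∪ T) : Set α) \ D := by
  ext e
  have h1 := hI e
  have h2 := hT' e
  simp only [Finset.coe_union, Set.mem_union, Set.mem_sdiff, Finset.mem_coe]
  tauto

/-- Coercion of `I ∪ (F ∖ T')` for `T' = T minus D`, when `D` misses `I` and every element of `D` inside `F` lies in `T`: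
the splice taking the values of `I ∪ T` on `D` and of `I ∪ (F ∖ T)` off `D`. [this work] -/
theorem coe_union_sdiff_filter_not (I F T T' : Finset α) (D : Set α) (hT : T ⊆ F)
    (hT' : ∀ e, e ∈ T' ↔ e ∈ T ∧ e ∉ D) (hI : ∀ e ∈ D, e ∉ I) (hDT : ∀ e ∈ D, e ∈ F → e ∈ T) :
    (↑(I ∪ (F \ T')) : Set α) = ((↑(I ∪ T) : Set α) ∩ D) ∪ ((↑(I ∪ (F \ T)) : Set α) \ D) := by
  ext e
  have h1 : e ∈ T → e ∈ F := fun h => hT h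
  have h2 := hT' e
  have h3 := hI e
  have h4 := hDT e
  simp only [Finset.coe_union, Finset.coe_sdiff, Set.mem_union, Set.mem_sdiff, Set.mem_inter_iff, Finset.mem_coe]
  tauto

/-- Recovering `T` from `T' = T minus D` and `G' = {e ∈ F | e ∈ D}` when every element of `D` inside `F` lies in `T`. [this work] -/
theorem eq_filter_not_union_filter (F T T' G' : Finset α) (D : Set α) (hT : T ⊆ F)
    (hT' : ∀ e, e ∈ T' ↔ e ∈ T ∧ e ∉ D) (hG' : ∀ e, e ∈ G' ↔ e ∈ F ∧ e ∈ D) (hDT : ∀ e ∈ D, e ∈ F → e ∈ T) :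
    T = T' ∪ G' := by
  ext e
  have h1 : e ∈ T → e ∈ F := fun h => hT h
  have h2 := hT' e
  have h3 := hG' e
  have h4 := hDT e
  simp only [Finset.mem_union]
  tauto

end Flip

/-! ### The seal and the cut-off as injections of finite sets (one class `I ∪ ·` over the free edges `F`) -/

section Count

variable [Fintype V] [DecidableEq V]

/-- **Seal towards `c`, counting form.**  In a class with forced-open edges `I` and free edges `F` (configurations
`C₁ = I ∪ T`, `C₂ = I ∪ (F ∖ T)`, `T ⊆ F`): the number of `T` with `a ↮ c` in `C₂` and `a ↔ b` in `C₁` off the edges touching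
`K = C_c(C₂)` is at most the number of `T` with `I ∪ T ∈ ab|c` — flip `T` on the edges of `F` touching `K` (the seal of p1 g40,
✓ p575478 `seal_reachable_iff[_of_not_mem]`); the image determines `K` as its own `c`-cluster, hence the flip is injective. [this work] -/
theorem classCount_seal_le (I F : Finset (Sym2 V)) (a b c : V) :
    ((F.powerset.filter fun T =>
        ¬ (openGraph (↑(I ∪ (F \ T)) : Set (Sym2 V))).Reachable a c ∧
        (openGraph ((↑(I ∪ T) : Set (Sym2 V)) \
          {e | ∃ v ∈ {v | (openGraph (↑(I ∪ (F \ T)) : Set (Sym2 V))).Reachable c v}, v ∈ e})).Reachable a b).card) ≤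
    (F.powerset.filter fun T =>
        (openGraph (↑(I ∪ T) : Set (Sym2 V))).Reachable a b ∧
          ¬ (openGraph (↑(I ∪ T) : Set (Sym2 V))).Reachable a c).card := by
  let K : Finset (Sym2 V) → Set V := fun T => {v | (openGraph (↑(I ∪ (F \ T)) : Set (Sym2 V))).Reachable c v}
  let TK : Finset (Sym2 V) → Set (Sym2 V) := fun T => {e | ∃ v ∈ K T, v ∈ e}
  let G : Finset (Sym2 V) → Finset (Sym2 V) := fun T => F.filter fun e => e ∈ TK T
  let f : Finset (Sym2 V) → Finset (Sym2 V) := fun T => (T \ G T) ∪ ((F \ T) ∩ G T)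
  have hG : ∀ T e, e ∈ G T ↔ e ∈ F ∧ e ∈ TK T := fun T e => Finset.mem_filter
  -- the image is the seal `Y_c = (C₂ ∩ TK) ∪ (C₁ ∖ TK)`, whose `c`-cluster is `K`
  have hcoe : ∀ T ⊆ F, (↑(I ∪ f T) : Set (Sym2 V)) =
      ((↑(I ∪ (F \ T)) : Set (Sym2 V)) ∩ TK T) ∪ ((↑(I ∪ T) : Set (Sym2 V)) \ TK T) :=
    fun T hT => coe_union_flipOn I F T (G T) (TK T) hT (hG T)
  have hK : ∀ T ⊆ F, K T = {v | (openGraph (↑(I ∪ f T) : Set (Sym2 V))).Reachable c v} := by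
    intro T hT
    ext v
    rw [hcoe T hT]
    exact (seal_reachable_iff ((↑(I ∪ T) : Set (Sym2 V))) ((↑(I ∪ (F \ T)) : Set (Sym2 V))) c (K T) (TK T) _ rfl rfl rfl v).symm
  refine Finset.card_le_card_of_injOn f (fun T hT => ?_) (fun T₁ h₁ T₂ h₂ heq => ?_)
  · rw [Finset.mem_coe, Finset.mem_filter, Finset.mem_powerset] at hT ⊢
    obtain ⟨hTF, hac, hab⟩ := hT
    have haK : a ∉ K T := fun h => hac h.symm
    refine ⟨flipOn_subset F (G T) T hTF, ?_, ?_⟩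
    · rw [hcoe T hTF]
      exact (seal_reachable_iff_of_not_mem ((↑(I ∪ T) : Set (Sym2 V))) ((↑(I ∪ (F \ T)) : Set (Sym2 V))) c (K T) (TK T) _ rfl rfl rfl haK b).2 hab
    · rw [hcoe T hTF]
      intro h
      exact haK ((seal_reachable_iff ((↑(I ∪ T) : Set (Sym2 V))) ((↑(I ∪ (F \ T)) : Set (Sym2 V))) c (K T) (TK T) _ rfl rfl rfl a).1 h.symm)
  · rw [Finset.coe_filter] at h₁ h₂
    have hT₁ : T₁ ⊆ F := Finset.mem_powerset.1 h₁.1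
    have hT₂ : T₂ ⊆ F := Finset.mem_powerset.1 h₂.1
    have hTK : TK T₁ = TK T₂ := by
      change {e | ∃ v ∈ K T₁, v ∈ e} = {e | ∃ v ∈ K T₂, v ∈ e}
      rw [hK T₁ hT₁, hK T₂ hT₂, heq]
    have hGeq : G T₁ = G T₂ := by
      ext e
      rw [hG, hG, hTK]
    have e1 : T₁ = ((f T₁ \ G T₁) ∪ ((F \ f T₁) ∩ G T₁)) := (flipOn_flipOn F (G T₁) T₁ hT₁).symm
    have e2 : T₂ = ((f T₂ \ G T₂) ∪ ((F \ f T₂) ∩ G T₂)) := (flipOn_flipOn F (G T₂) T₂ hT₂).symm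
    rw [e1, e2, heq, hGeq]

/-- **Cut-off towards `c`, counting form.**  In a class (`C₁ = I ∪ T`, `C₂ = I ∪ (F ∖ T)`): the number of `T` with `b ↮ c` in
`C₂`, the `b`-seal failing (`a ↮ c` in `C₁` off the edges touching `S = C_b(C₂)`) and `a ↔ b` in `C₁ ∖ E(Q, S)` (`Q` the
`C₁`-cluster of `c` avoiding `S`) is at most the number of `T` with `I ∪ T ∈ ab|c` — delete `E(Q, S)` from `T` (the cut-off of
✓ p611042; every such edge lies in `T`), decoded by `cut_reachable_iff` and `cut_decode_b`. [this work] -/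
theorem classCount_cut_le (I F : Finset (Sym2 V)) (a b c : V) :
    ((F.powerset.filter fun T =>
        ¬ (openGraph (↑(I ∪ (F \ T)) : Set (Sym2 V))).Reachable b c ∧
        ¬ (openGraph ((↑(I ∪ T) : Set (Sym2 V)) \
            {e | ∃ v ∈ {v | (openGraph (↑(I ∪ (F \ T)) : Set (Sym2 V))).Reachable b v}, v ∈ e})).Reachable a c ∧
        (openGraph ((↑(I ∪ T) : Set (Sym2 V)) \
            {e | ∃ q ∈ {q | (openGraph ((↑(I ∪ T) : Set (Sym2 V)) \
                  {e | ∃ v ∈ {v | (openGraph (↑(I ∪ (F \ T)) : Set (Sym2 V))).Reachable b v}, v ∈ e})).Reachable c q},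
                 ∃ s ∈ {v | (openGraph (↑(I ∪ (F \ T)) : Set (Sym2 V))).Reachable b v}, e = s(q, s)})).Reachable a b).card) ≤
    (F.powerset.filter fun T =>
        (openGraph (↑(I ∪ T) : Set (Sym2 V))).Reachable a b ∧
          ¬ (openGraph (↑(I ∪ T) : Set (Sym2 V))).Reachable a c).card := by
  let S : Finset (Sym2 V) → Set V := fun T => {v | (openGraph (↑(I ∪ (F \ T)) : Set (Sym2 V))).Reachable b v}
  let TS : Finset (Sym2 V) → Set (Sym2 V) := fun T => {e | ∃ v ∈ S T, v ∈ e}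
  let Q : Finset (Sym2 V) → Set V := fun T => {q | (openGraph ((↑(I ∪ T) : Set (Sym2 V)) \ TS T)).Reachable c q}
  let D : Finset (Sym2 V) → Set (Sym2 V) := fun T => {e | ∃ q ∈ Q T, ∃ s ∈ S T, e = s(q, s)}
  let g : Finset (Sym2 V) → Finset (Sym2 V) := fun T => T.filter fun e => e ∉ D T
  let G' : Finset (Sym2 V) → Finset (Sym2 V) := fun T => F.filter fun e => e ∈ D T
  have hg : ∀ T e, e ∈ g T ↔ e ∈ T ∧ e ∉ D T := fun T e => Finset.mem_filter
  have hG' : ∀ T e, e ∈ G' T ↔ e ∈ F ∧ e ∈ D T := fun T e => Finset.mem_filter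
  -- decoder, reading the region off the image `g T`
  let Qd : Finset (Sym2 V) → Set V := fun T' => {q | (openGraph (↑(I ∪ T') : Set (Sym2 V))).Reachable c q}
  let Sd : Finset (Sym2 V) → Set V := fun T' =>
    {s | (openGraph ((↑(I ∪ (F \ T')) : Set (Sym2 V)) \ {e | ∃ u ∈ Qd T', u ∈ e})).Reachable b s}
  let Dd : Finset (Sym2 V) → Set (Sym2 V) := fun T' => {e | ∃ q ∈ Qd T', ∃ s ∈ Sd T', e = s(q, s)}
  -- the cut edges are `C₂`-closed: they miss `I`, and inside `F` they lie in `T`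
  have hDC₂ : ∀ T, ¬ (openGraph (↑(I ∪ (F \ T)) : Set (Sym2 V))).Reachable b c →
      ∀ e ∈ D T, e ∉ (↑(I ∪ (F \ T)) : Set (Sym2 V)) :=
    fun T hbc e he => cut_not_mem_of_mem_F ((↑(I ∪ T) : Set (Sym2 V))) ((↑(I ∪ (F \ T)) : Set (Sym2 V))) b c (S T) (Q T) (TS T) (D T)
      rfl rfl rfl rfl (fun h => hbc h) he
  have hDI : ∀ T, ¬ (openGraph (↑(I ∪ (F \ T)) : Set (Sym2 V))).Reachable b c → ∀ e ∈ D T, e ∉ I := by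
    intro T hbc e he heI
    exact hDC₂ T hbc e he (by rw [Finset.coe_union]; exact Or.inl heI)
  have hDT : ∀ T, ¬ (openGraph (↑(I ∪ (F \ T)) : Set (Sym2 V))).Reachable b c → ∀ e ∈ D T, e ∈ F → e ∈ T := by
    intro T hbc e he heF
    by_contra heT
    exact hDC₂ T hbc e he (by rw [Finset.coe_union, Finset.coe_sdiff]; exact Or.inr ⟨heF, heT⟩)
  have hcoe1 : ∀ T, ¬ (openGraph (↑(I ∪ (F \ T)) : Set (Sym2 V))).Reachable b c →
      (↑(I ∪ g T) : Set (Sym2 V)) = (↑(I ∪ T) : Set (Sym2 V)) \ D T :=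
    fun T hbc => coe_union_filter_not I T (g T) (D T) (hg T) (hDI T hbc)
  have hcoe2 : ∀ T ⊆ F, ¬ (openGraph (↑(I ∪ (F \ T)) : Set (Sym2 V))).Reachable b c →
      (↑(I ∪ (F \ g T)) : Set (Sym2 V)) =
        ((↑(I ∪ T) : Set (Sym2 V)) ∩ D T) ∪ ((↑(I ∪ (F \ T)) : Set (Sym2 V)) \ D T) :=
    fun T hT hbc => coe_union_sdiff_filter_not I F T (g T) (D T) hT (hg T) (hDI T hbc) (hDT T hbc)
  have hQd : ∀ T, ¬ (openGraph (↑(I ∪ (F \ T)) : Set (Sym2 V))).Reachable b c → Qd (g T) = Q T := by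
    intro T hbc
    ext q
    change (openGraph (↑(I ∪ g T) : Set (Sym2 V))).Reachable c q ↔
      (openGraph ((↑(I ∪ T) : Set (Sym2 V)) \ TS T)).Reachable c q
    rw [hcoe1 T hbc]
    exact cut_reachable_iff ((↑(I ∪ T) : Set (Sym2 V))) c (S T) (Q T) (TS T) (D T) rfl rfl rfl (fun h => hbc h) q
  have hSd : ∀ T ⊆ F, ¬ (openGraph (↑(I ∪ (F \ T)) : Set (Sym2 V))).Reachable b c → Sd (g T) = S T := by
    intro T hT hbc
    ext s
    change (openGraph ((↑(I ∪ (F \ g T)) : Set (Sym2 V)) \ {e | ∃ u ∈ Qd (g T), u ∈ e})).Reachable b s ↔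
      (openGraph (↑(I ∪ (F \ T)) : Set (Sym2 V))).Reachable b s
    rw [hcoe2 T hT hbc, hQd T hbc]
    exact cut_decode_b ((↑(I ∪ T) : Set (Sym2 V))) ((↑(I ∪ (F \ T)) : Set (Sym2 V))) b c (S T) (Q T) (TS T) (D T) rfl rfl rfl rfl (fun h => hbc h) s
  have hDd : ∀ T ⊆ F, ¬ (openGraph (↑(I ∪ (F \ T)) : Set (Sym2 V))).Reachable b c → Dd (g T) = D T := by
    intro T hT hbc
    ext e
    change (∃ q ∈ Qd (g T), ∃ s ∈ Sd (g T), e = s(q, s)) ↔ (∃ q ∈ Q T, ∃ s ∈ S T, e = s(q, s))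
    rw [hQd T hbc, hSd T hT hbc]
  refine Finset.card_le_card_of_injOn g (fun T hT => ?_) (fun T₁ h₁ T₂ h₂ heq => ?_)
  · rw [Finset.mem_coe, Finset.mem_filter, Finset.mem_powerset] at hT ⊢
    obtain ⟨hTF, hbc, hac, hab⟩ := hT
    refine ⟨(Finset.filter_subset _ T).trans hTF, ?_, ?_⟩
    · rw [hcoe1 T hbc]; exact hab
    · rw [hcoe1 T hbc]
      intro h
      exact hac ((cut_reachable_iff ((↑(I ∪ T) : Set (Sym2 V))) c (S T) (Q T) (TS T) (D T) rfl rfl rfl (fun h' => hbc h') a).1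
        h.symm).symm
  · rw [Finset.coe_filter] at h₁ h₂
    have hT₁ : T₁ ⊆ F := Finset.mem_powerset.1 h₁.1
    have hT₂ : T₂ ⊆ F := Finset.mem_powerset.1 h₂.1
    have hD : D T₁ = D T₂ := by rw [← hDd T₁ hT₁ h₁.2.1, ← hDd T₂ hT₂ h₂.2.1, heq]
    have hG'eq : G' T₁ = G' T₂ := by
      ext e
      rw [hG', hG', hD]
    have e1 : T₁ = g T₁ ∪ G' T₁ :=
      eq_filter_not_union_filter F T₁ (g T₁) (G' T₁) (D T₁) hT₁ (hg T₁) (hG' T₁) (hDT T₁ h₁.2.1)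
    have e2 : T₂ = g T₂ ∪ G' T₂ :=
      eq_filter_not_union_filter F T₂ (g T₂) (G' T₂) (D T₂) hT₂ (hg T₂) (hG' T₂) (hDT T₂ h₂.2.1)
    rw [e1, e2, heq, hG'eq]


end Count

end ThreeClusterSwap

end Summit.CriticalPhenomena.PercolationContinuityZ3.Theorems
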